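import Mathlib.FieldTheory.IsAlgClosed.Basic
import Mathlib.RingTheory.RootsOfUnity.PrimitiveRoots
import Mathlib.Topology.LocallyConstant.Basic
import Mathlib.Topology.Algebra.ClopenNhdofOne
import Mathlib.Topology.Algebra.Valued.ValuedField
import Mathlib.RingTheory.Valuation.ValuationRing
import Mathlib.RingTheory.Valuation.Integers
import Mathlib.LinearAlgebra.Matrix.Reindex
import Mathlib.Algebra.CharP.Lemmas
import Literature.NumberTheory.GaloisRepresentations.ProjectiveLifting
import Literature.NumberTheory.GaloisRepresentations.TateProjectiveLifting
import HarnessLib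

/-!
# Tate's lifting theorem for projective representations of `G_ℚ`: the obstruction layer

Sibling proof file of `TateProjectiveLifting.lean` (named fact `Tate_projectiveLifting`,
Serre, Durham 1977, §6.1, Corollary to Theorem 4; Bosman 2011, §7.2.1–7.2.2); the
character-twisting layer of §6.2 (Theorem 5) is the other sibling,
`TateProjectiveLiftingProofs.lean`.

The printed proof (Serre §6.1 and §6.5) has two layers:

* **[OBS]** (§6.1, "The obstruction to the existence of a lifting of `ρ̃` is an element of
  `H²(G_K, ℂ^×)`"): choose a set-theoretic lift `s` of `ρ̃`, normalise `det s = 1`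
  (`n`-th roots exist in an algebraically closed field), so that
  `s(σ) s(τ) = z(σ,τ) s(στ)` with `z` a `μ_n`-valued `2`-cocycle; if `z` is a coboundary
  `z(σ,τ) b(στ) = b(σ) b(τ)` then `W = b⁻¹ s` is a homomorphism lifting `ρ̃`.  For discrete
  coefficients and a `ρ̃` with open kernel everything in sight is locally constant, so `W` is
  continuous.
* **[TATE]** (§6.5, Theorem 4: `H²(G_K, ℚ/ℤ) = 0`, global class field theory — idele class
  characters with prescribed restrictions to the local roots of unity, local invariants of the
  Brauer group): kills the class of `z` after pushing it into `ℚ/ℤ` ("the cokernel of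
  `ℚ/ℤ → ℂ^×` is uniquely divisible", resp. Bosman: "the proof works for representations over
  arbitrary algebraically closed fields" — the `μ_d`-valued class is pushed into `ℚ/ℤ` along
  `ζ^a ↦ a/d` and pulled back along `u/N ↦ ξ^u`, `ξ^{N/d} = ζ`).

This file proves **[OBS]** for an arbitrary topological group and an arbitrary algebraically
closed coefficient field (any characteristic), and the bookkeeping half of **[TATE]** (the passage
between `μ_∞(k)`-valued and `ℚ/ℤ`-valued cochains), whence
`Tate_projectiveLifting_of_H2_addCircle`: *Tate's theorem for `ℚ` in cochain form — every locally
constant `2`-cocycle `G_ℚ × G_ℚ → ℚ/ℤ` is the coboundary of a locally constant cochain — implies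
`Tate_projectiveLifting`*.  The hypothesis is literally the one under which the sibling file
`ProjectiveLiftingProofs.lean` derives the `ℓ`-adic avatar `Patrikis2019_exists_lift_projective`
(i) (`Patrikis2019_exists_lift_of_H2_addCircle`).  **[TATE]** itself (Serre §6.5) is global class
field theory and is not available in Mathlib or in this tree.

## References

* J.-P. Serre, *Modular forms of weight one and Galois representations*, in: Algebraic Number
  Fields (Durham 1975), Academic Press 1977, §6.1 (Thm. 4 (Tate), Corollary), §6.5 (proof).
  [`SerreDurham1977`]
* J. Bosman, *Polynomials for projective representations of level one forms*, Ch. 7 in: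
  Computational Aspects of Modular Forms and Galois Representations, Ann. of Math. Stud. 176
  (2011), §7.2.1–7.2.2. [`Bosman2011ProjectivePolynomials`]
-/

noncomputable section

open scoped NumberField MatrixGroups
open Field Matrix

namespace Literature.NumberTheory.GaloisRepresentations

/-! ### `ℚ/ℤ = AddCircle (1 : ℚ)` bookkeeping -/

section AddCircleAux

/-- Two fractions `u/N`, `v/N` (`u v : ℤ`) agree in `ℚ/ℤ = AddCircle (1 : ℚ)` iff `N ∣ u - v`.
[folklore] -/
theorem addCircle_intCast_div_eq_intCast_div_iff {N : ℕ} (hN : N ≠ 0) (u v : ℤ) :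
    (((u : ℚ) / N : ℚ) : AddCircle (1 : ℚ)) = (((v : ℚ) / N : ℚ) : AddCircle (1 : ℚ)) ↔
      (N : ℤ) ∣ u - v := by
  rw [QuotientAddGroup.eq_iff_sub_mem, AddSubgroup.mem_zmultiples_iff]
  have hN' : (N : ℚ) ≠ 0 := Nat.cast_ne_zero.2 hN
  constructor
  · rintro ⟨m, hm⟩
    rw [zsmul_eq_mul, mul_one, div_sub_div_same, eq_div_iff hN'] at hm
    refine ⟨m, ?_⟩
    have hm' : ((u - v : ℤ) : ℚ) = ((N * m : ℤ) : ℚ) := by push_cast; linarith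
    exact_mod_cast hm'
  · rintro ⟨c, hc⟩
    refine ⟨c, ?_⟩
    rw [zsmul_eq_mul, mul_one, div_sub_div_same, eq_div_iff hN']
    have h : ((u - v : ℤ) : ℚ) = ((N * c : ℤ) : ℚ) := by rw [hc]
    push_cast at h
    linarith

/-- An `N`-torsion element of `ℚ/ℤ = AddCircle (1 : ℚ)` is a fraction `k/N`. [folklore] -/
theorem addCircle_exists_eq_intCast_div_of_nsmul_eq_zero {N : ℕ} (hN : N ≠ 0)
    {x : AddCircle (1 : ℚ)} (hx : N • x = 0) :
    ∃ k : ℤ, x = (((k : ℚ) / N : ℚ) : AddCircle (1 : ℚ)) := by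
  obtain ⟨q, rfl⟩ := QuotientAddGroup.mk_surjective x
  rw [← QuotientAddGroup.mk_nsmul, QuotientAddGroup.eq_zero_iff, AddSubgroup.mem_zmultiples_iff]
    at hx
  obtain ⟨m, hm⟩ := hx
  rw [zsmul_eq_mul, mul_one, nsmul_eq_mul] at hm
  refine ⟨m, ?_⟩
  congr 1
  rw [eq_div_iff (Nat.cast_ne_zero.2 hN : (N : ℚ) ≠ 0), hm, mul_comm]

/-- Every element of `ℚ/ℤ = AddCircle (1 : ℚ)` is torsion. [folklore] -/
theorem addCircle_exists_nsmul_eq_zero (x : AddCircle (1 : ℚ)) :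
    ∃ m : ℕ, 0 < m ∧ m • x = 0 := by
  obtain ⟨q, rfl⟩ := QuotientAddGroup.mk_surjective x
  refine ⟨q.den, q.den_pos, ?_⟩
  rw [← QuotientAddGroup.mk_nsmul, QuotientAddGroup.eq_zero_iff, AddSubgroup.mem_zmultiples_iff]
  refine ⟨q.num, ?_⟩
  rw [zsmul_eq_mul, mul_one, nsmul_eq_mul, mul_comm, Rat.mul_den_eq_num]

/-- A map with finite range into `ℚ/ℤ` is killed by a positive integer. [folklore] -/
theorem addCircle_exists_nsmul_comp_eq_zero {X : Type*} (b : X → AddCircle (1 : ℚ))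
    (hb : (Set.range b).Finite) : ∃ M : ℕ, 0 < M ∧ ∀ x, M • b x = 0 := by
  classical
  choose m hm0 hmx using addCircle_exists_nsmul_eq_zero
  refine ⟨∏ y ∈ hb.toFinset, m y, Finset.prod_pos fun y _ => hm0 y, fun x => ?_⟩
  have hmem : b x ∈ hb.toFinset := by
    rw [Set.Finite.mem_toFinset]
    exact ⟨x, rfl⟩
  obtain ⟨c, hc⟩ := Finset.dvd_prod_of_mem m hmem
  rw [hc, mul_nsmul, hmx, nsmul_zero]

end AddCircleAux

/-! ### From `ℚ/ℤ`-valued splittings to `kˣ`-valued splittings (discrete coefficients) -/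

section DiscreteSplitting

variable {Γ : Type*} [Group Γ] [TopologicalSpace Γ] [CompactSpace Γ]
variable {k : Type*} [Field k] [IsAlgClosed k]

/-- **Pushing the obstruction into `ℚ/ℤ` and back** (Serre, Durham §6.5, first paragraph:
`H²(G_K, ℂ^×) = H²(G_K, ℚ/ℤ)`; Bosman §7.2.1: "the proof works for representations over arbitrary
algebraically closed fields").  Let `Γ` be a compact topological group and `k` an algebraically
closed field of any characteristic.  If every locally constant `2`-cocycle
`Γ × Γ → ℚ/ℤ = AddCircle (1 : ℚ)` (trivial action) is the coboundary of a locally constant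
cochain, then every locally constant `2`-cocycle `z` with `zⁿ = 1` (`n ≥ 1`) is the coboundary
`z(σ,τ) b(στ) = b(σ) b(τ)` of a locally constant `kˣ`-valued cochain `b`.  Proof: `μ_n(k)` is
cyclic, generated by a primitive `d`-th root of unity `ζ`; write `z = ζ^a`, push `a/d` into
`ℚ/ℤ`, split it there as `δb`; `b` has finite image hence values in `(1/N)ℤ/ℤ`, `N = dM`, and
`u/N ↦ ξ^u` with `ξ^M = ζ` (so `ξ^N = 1`) turns the additive splitting into a multiplicative one.
[cite: SerreDurham1977, §6.5 (preliminary paragraph)] -/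
theorem twoCocycle_split_of_addCircle_of_isLocallyConstant {n : ℕ} (hn : 0 < n)
    (H : ∀ f : Γ → Γ → AddCircle (1 : ℚ), IsLocallyConstant (Function.uncurry f) →
      (∀ σ τ υ, f σ τ + f (σ * τ) υ = f τ υ + f σ (τ * υ)) →
      ∃ b : Γ → AddCircle (1 : ℚ), IsLocallyConstant b ∧ ∀ σ τ, f σ τ + b (σ * τ) = b σ + b τ)
    (z : Γ → Γ → k) (hzlc : IsLocallyConstant (Function.uncurry z)) (hzn : ∀ σ τ, z σ τ ^ n = 1)
    (hzz : ∀ σ τ υ, z σ τ * z (σ * τ) υ = z τ υ * z σ (τ * υ)) :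
    ∃ b : Γ → k, IsLocallyConstant b ∧ (∀ σ, b σ ≠ 0) ∧ ∀ σ τ, z σ τ * b (σ * τ) = b σ * b τ := by
  classical
  -- a generator `ζ` of the finite cyclic group `μ_n(k)`; it is a primitive `d`-th root of unity
  haveI : NeZero n := ⟨hn.ne'⟩
  obtain ⟨g, hg⟩ := IsCyclic.exists_zpow_surjective (G := rootsOfUnity n k)
  set ζ : k := ((g : kˣ) : k) with hζ_def
  set d : ℕ := orderOf ζ with hd_def
  have hζ : IsPrimitiveRoot ζ d := IsPrimitiveRoot.orderOf ζ
  have hgn : ((g : kˣ) : k) ^ n = 1 := by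
    have h := g.2
    rw [mem_rootsOfUnity] at h
    rw [← Units.val_pow_eq_pow_val, h, Units.val_one]
  have hd : 0 < d := orderOf_pos_iff.2 (isOfFinOrder_iff_pow_eq_one.2 ⟨n, hn, hgn⟩)
  haveI : NeZero d := ⟨hd.ne'⟩
  have hζ0 : ζ ≠ 0 := hζ.ne_zero hd.ne'
  -- every value of `z` is a power of `ζ`, hence a `d`-th root of unity
  have hzd : ∀ σ τ, z σ τ ^ d = 1 := by
    intro σ τ
    obtain ⟨m, hm⟩ := hg (rootsOfUnity.mkOfPowEq (z σ τ) (hzn σ τ))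
    have hzm : z σ τ = ζ ^ m := by
      have h := congrArg (fun u : rootsOfUnity n k => ((u : kˣ) : k)) hm
      simp only [rootsOfUnity.val_mkOfPowEq_coe] at h
      rw [← h, SubgroupClass.coe_zpow, Units.val_zpow_eq_zpow_val]
    rw [hzm, ← zpow_natCast, ← zpow_mul, mul_comm, zpow_mul, zpow_natCast, hζ.pow_eq_one,
      one_zpow]
  -- exponents of `ζ` are determined modulo `d`
  have hexp : ∀ {i j : ℕ}, ζ ^ i = ζ ^ j → (d : ℤ) ∣ (i : ℤ) - j := by
    intro i j hij
    rw [← hζ.zpow_eq_one_iff_dvd, zpow_sub₀ hζ0, zpow_natCast, zpow_natCast, hij,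
      div_self (pow_ne_zero _ hζ0)]
  -- discrete logarithm to the base `ζ` on `μ_d(k)`
  obtain ⟨dlog, hdlog_def⟩ : ∃ dlog : k → ℕ, dlog = fun ξ =>
      if hξ : ξ ^ d = 1 then Classical.choose (hζ.eq_pow_of_pow_eq_one hξ) else 0 := ⟨_, rfl⟩
  have hdlog : ∀ {ξ : k}, ξ ^ d = 1 → ζ ^ dlog ξ = ξ := by
    intro ξ hξ
    simp only [hdlog_def]
    rw [dif_pos hξ]
    exact (Classical.choose_spec (hζ.eq_pow_of_pow_eq_one hξ)).2
  have ha : ∀ σ τ, ζ ^ dlog (z σ τ) = z σ τ := fun σ τ => hdlog (hzd σ τ)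
  -- the `ℚ/ℤ`-valued cocycle `f = dlog(z) / d`
  obtain ⟨f, hf_def⟩ : ∃ f : Γ → Γ → AddCircle (1 : ℚ),
      f = fun σ τ => (((dlog (z σ τ) : ℚ) / d : ℚ) : AddCircle (1 : ℚ)) := ⟨_, rfl⟩
  have hf_lc : IsLocallyConstant (Function.uncurry f) := by
    rw [hf_def]
    exact hzlc.comp fun ξ : k => (((dlog ξ : ℚ) / d : ℚ) : AddCircle (1 : ℚ))
  have hf_coc : ∀ σ τ υ, f σ τ + f (σ * τ) υ = f τ υ + f σ (τ * υ) := by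
    intro σ τ υ
    simp only [hf_def]
    rw [← QuotientAddGroup.mk_add, ← QuotientAddGroup.mk_add, ← add_div, ← add_div]
    have key : (d : ℤ) ∣ ((dlog (z σ τ) + dlog (z (σ * τ) υ) : ℕ) : ℤ) -
        ((dlog (z τ υ) + dlog (z σ (τ * υ)) : ℕ) : ℤ) :=
      hexp (by rw [pow_add, pow_add, ha, ha, ha, ha, hzz])
    have h := (addCircle_intCast_div_eq_intCast_div_iff hd.ne' _ _).2 key
    push_cast at h
    exact h
  -- Tate: `f` splits in `ℚ/ℤ`
  obtain ⟨bq, hbq_lc, hbq⟩ := H f hf_lc hf_coc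
  -- `bq` has finite image, hence bounded denominators: `M • bq = 0`
  obtain ⟨M, hM0, hMb⟩ := addCircle_exists_nsmul_comp_eq_zero bq hbq_lc.range_finite
  set N : ℕ := d * M with hN_def
  have hN0 : N ≠ 0 := (Nat.mul_pos hd hM0).ne'
  have hNb : ∀ σ, N • bq σ = 0 := by
    intro σ
    rw [hN_def, mul_comm, mul_nsmul, hMb, nsmul_zero]
  -- representatives `κ x / N` of the `N`-torsion values
  have hrep : ∀ x : AddCircle (1 : ℚ), ∃ k : ℤ,
      N • x = 0 → x = (((k : ℚ) / N : ℚ) : AddCircle (1 : ℚ)) := by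
    intro x
    by_cases hx : N • x = 0
    · obtain ⟨k, hk⟩ := addCircle_exists_eq_intCast_div_of_nsmul_eq_zero hN0 hx
      exact ⟨k, fun _ => hk⟩
    · exact ⟨0, fun h => absurd h hx⟩
  choose κ hκ using hrep
  -- an `M`-th root `ξ` of `ζ`: `ξ ^ N = 1`
  obtain ⟨ξ, hξM⟩ := IsAlgClosed.exists_pow_nat_eq ζ hM0
  have hξ0 : ξ ≠ 0 := by
    intro h0
    rw [h0, zero_pow hM0.ne'] at hξM
    exact hζ0 hξM.symm
  set ξu : kˣ := Units.mk0 ξ hξ0 with hξu_def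
  have hξuN : ξu ^ N = 1 := by
    ext
    rw [Units.val_pow_eq_pow_val, Units.val_mk0, hN_def, mul_comm, pow_mul, hξM, hζ.pow_eq_one,
      Units.val_one]
  have hξpow : ∀ {e₁ e₂ : ℤ}, (N : ℤ) ∣ e₁ - e₂ → ξu ^ e₁ = ξu ^ e₂ := by
    rintro e₁ e₂ ⟨c, hc⟩
    rw [show e₁ = e₂ + N * c by linarith, zpow_add, zpow_mul, zpow_natCast, hξuN, one_zpow,
      mul_one]
  have hξz : ∀ σ τ, ((ξu ^ ((dlog (z σ τ) * M : ℕ) : ℤ) : kˣ) : k) = z σ τ := by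
    intro σ τ
    rw [zpow_natCast, Units.val_pow_eq_pow_val, Units.val_mk0, mul_comm, pow_mul, hξM, ha]
  -- the multiplicative splitting `B = ξ ^ (N bq)`
  refine ⟨fun σ => ((ξu ^ κ (bq σ) : kˣ) : k), ?_, fun σ => Units.ne_zero _, fun σ τ => ?_⟩
  · exact hbq_lc.comp fun x => ((ξu ^ κ x : kˣ) : k)
  · have hf_rep : f σ τ = ((((dlog (z σ τ) * M : ℕ) : ℤ) : ℚ) / N : ℚ) := by
      simp only [hf_def]
      congr 1
      rw [hN_def]
      push_cast
      rw [mul_div_mul_right _ _ (Nat.cast_ne_zero.2 hM0.ne' : (M : ℚ) ≠ 0)]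
    have h := hbq σ τ
    rw [hf_rep, hκ (bq (σ * τ)) (hNb _), hκ (bq σ) (hNb _), hκ (bq τ) (hNb _),
      ← QuotientAddGroup.mk_add, ← QuotientAddGroup.mk_add, ← add_div, ← add_div] at h
    have hdvd : (N : ℤ) ∣ (((dlog (z σ τ) * M : ℕ) : ℤ) + κ (bq (σ * τ))) -
        (κ (bq σ) + κ (bq τ)) := by
      refine (addCircle_intCast_div_eq_intCast_div_iff hN0 _ _).1 ?_
      push_cast at h ⊢
      exact h
    have hunits : ξu ^ (((dlog (z σ τ) * M : ℕ) : ℤ)) * ξu ^ κ (bq (σ * τ)) =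
        ξu ^ κ (bq σ) * ξu ^ κ (bq τ) := by
      rw [← zpow_add, ← zpow_add]
      exact hξpow hdvd
    have hval := congrArg (fun u : kˣ => (u : k)) hunits
    simp only [Units.val_mul] at hval
    rw [hξz] at hval
    exact hval

end DiscreteSplitting

/-! ### The obstruction layer for discrete coefficients -/

section DiscreteReduction

variable {Γ : Type*} [Group Γ] [TopologicalSpace Γ] [ContinuousMul Γ]
variable {k : Type*} [Field k] [TopologicalSpace k] {n : ℕ}

/-- A group homomorphism with open kernel out of a topological group is locally constant (it is
constant on the cosets of its kernel). [folklore] -/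
theorem isLocallyConstant_of_isOpen_ker {H : Type*} [Group H] (φ : Γ →* H)
    (hφ : IsOpen ((φ.ker : Subgroup Γ) : Set Γ)) : IsLocallyConstant φ := by
  rw [IsLocallyConstant.iff_exists_open]
  intro σ
  refine ⟨{τ | σ⁻¹ * τ ∈ φ.ker}, hφ.preimage (continuous_const.mul continuous_id), ?_, ?_⟩
  · simp
  · intro τ hτ
    simp only [Set.mem_setOf_eq, MonoidHom.mem_ker, map_mul, map_inv, inv_mul_eq_one] at hτ
    exact hτ.symm

/-- Scalar matrices are central in `GL_n`. [folklore] -/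
theorem scalar_mem_center' {R : Type*} [CommRing R] {m : Type*} [Fintype m] [DecidableEq m]
    (u : Rˣ) : GeneralLinearGroup.scalar m u ∈ Subgroup.center (GL m R) := by
  rw [GeneralLinearGroup.center_eq_range_scalar]
  exact ⟨u, rfl⟩

variable [IsAlgClosed k]

/-- **The obstruction layer, discrete coefficients (Serre, Durham §6.1).**  Let `Γ` be a
topological group, `k` an algebraically closed field with any topology, and suppose that every
locally constant `2`-cocycle `z` on `Γ` with `zⁿ = 1` (trivial action:
`z(σ,τ) z(στ,υ) = z(τ,υ) z(σ,τυ)`) is the coboundary `z(σ,τ) b(στ) = b(σ) b(τ)` of a locally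
constant nowhere-vanishing cochain `b`.  Then every homomorphism
`r : Γ → PGL_n(k) = GL_n(k) ⧸ centre` with open kernel lifts to a continuous (indeed locally
constant) homomorphism `W : Γ → GL_n(k)`.  Proof: a set-theoretic lift `s₀` of `r` is locally
constant (constant on cosets of `ker r`); normalise it to `det s = 1` by `n`-th roots of the
determinant; then `s(σ) s(τ) = z(σ,τ) s(στ)` with `z(σ,τ)` central of determinant `1`, i.e.
`z ∈ μ_n(k)`, a locally constant `2`-cocycle — "the obstruction to the existence of a lifting";
if `z(σ,τ) b(στ) = b(σ) b(τ)` then `W = b⁻¹ s` is multiplicative and locally constant.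
[cite: SerreDurham1977, §6.1 (liftings and the obstruction in H²)] -/
theorem exists_continuousMonoidHom_lift_of_twoCocycle_discrete
    (hH2 : ∀ z : Γ → Γ → k, IsLocallyConstant (Function.uncurry z) → (∀ σ τ, z σ τ ^ n = 1) →
      (∀ σ τ υ, z σ τ * z (σ * τ) υ = z τ υ * z σ (τ * υ)) →
      ∃ b : Γ → k, IsLocallyConstant b ∧ (∀ σ, b σ ≠ 0) ∧ ∀ σ τ, z σ τ * b (σ * τ) = b σ * b τ)
    (r : Γ →* PGL(n, k)) (hr : IsOpen ((r.ker : Subgroup Γ) : Set Γ)) :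
    ∃ W : Γ →ₜ* GL (Fin n) k, IsLocallyConstant W ∧
      ∀ σ, Matrix.ProjGenLinGroup.mk (W σ) = r σ := by
  classical
  rcases Nat.eq_zero_or_pos n with hn | hn
  · subst hn
    refine ⟨1, IsLocallyConstant.const 1, fun σ => ?_⟩
    obtain ⟨g, hg⟩ := Matrix.ProjGenLinGroup.mk_surjective (r σ)
    rw [← hg, Subsingleton.elim g ((1 : Γ →ₜ* GL (Fin 0) k) σ)]
  haveI : Nonempty (Fin n) := ⟨⟨0, hn⟩⟩
  set i₀ : Fin n := ⟨0, hn⟩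
  -- Step 1: a locally constant set-theoretic lift.
  have hr_lc : IsLocallyConstant r := isLocallyConstant_of_isOpen_ker r hr
  obtain ⟨s₀, hs₀_def⟩ : ∃ s₀ : Γ → GL (Fin n) k,
      s₀ = fun σ => Function.surjInv Matrix.ProjGenLinGroup.mk_surjective (r σ) := ⟨_, rfl⟩
  have hs₀r : ∀ σ, Matrix.ProjGenLinGroup.mk (s₀ σ) = r σ := fun σ => by
    rw [hs₀_def]
    exact Function.surjInv_eq _ _
  have hs₀_lc : IsLocallyConstant s₀ := by
    rw [hs₀_def]
    exact hr_lc.comp (Function.surjInv Matrix.ProjGenLinGroup.mk_surjective)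
  -- Step 2: `n`-th roots of determinants, and the normalised lift `s`, `det s = 1`.
  have hroot : ∀ A : GL (Fin n) k, ∃ e : k, e ^ n = (A : Matrix (Fin n) (Fin n) k).det :=
    fun A => IsAlgClosed.exists_pow_nat_eq _ hn
  choose e he using hroot
  have hdet0 : ∀ A : GL (Fin n) k, (A : Matrix (Fin n) (Fin n) k).det ≠ 0 := fun A =>
    ((Matrix.isUnit_iff_isUnit_det _).1 A.isUnit).ne_zero
  have he0 : ∀ A, e A ≠ 0 := fun A h0 => by
    have h := he A
    rw [h0, zero_pow hn.ne'] at h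
    exact hdet0 A h.symm
  obtain ⟨nm, hnm_def⟩ : ∃ nm : GL (Fin n) k → GL (Fin n) k,
      nm = fun A => GeneralLinearGroup.scalar (Fin n) (Units.mk0 (e A) (he0 A))⁻¹ * A := ⟨_, rfl⟩
  obtain ⟨s, hs_def⟩ : ∃ s : Γ → GL (Fin n) k, s = fun σ => nm (s₀ σ) := ⟨_, rfl⟩
  have hs_lc : IsLocallyConstant s := by
    rw [hs_def]
    exact hs₀_lc.comp nm
  have hs_val : ∀ σ, (s σ : Matrix (Fin n) (Fin n) k) =
      (e (s₀ σ))⁻¹ • (s₀ σ : Matrix (Fin n) (Fin n) k) := by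
    intro σ
    simp only [hs_def, hnm_def, Units.val_mul, GeneralLinearGroup.coe_scalar,
      Units.val_inv_eq_inv_val, Units.val_mk0, scalar_apply, ← smul_eq_diagonal_mul]
  have hs_r : ∀ σ, Matrix.ProjGenLinGroup.mk (s σ) = r σ := by
    intro σ
    simp only [hs_def, hnm_def]
    rw [map_mul, Matrix.ProjGenLinGroup.mk_scalar, one_mul, hs₀r]
  have hs_det : ∀ σ, (s σ : Matrix (Fin n) (Fin n) k).det = 1 := by
    intro σ
    rw [hs_val, det_smul, Fintype.card_fin, inv_pow, he, inv_mul_cancel₀ (hdet0 _)]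
  have hS_ne : ∀ σ, (s σ : Matrix (Fin n) (Fin n) k) ≠ 0 := by
    intro σ h
    have := hs_det σ
    rw [h, det_zero] at this
    exact zero_ne_one this
  -- Step 3: the obstruction cocycle `c(σ,τ) = s σ s τ (s στ)⁻¹`, central of determinant one.
  obtain ⟨c, hc_def⟩ : ∃ c : Γ → Γ → GL (Fin n) k, c = fun σ τ => s σ * s τ * (s (σ * τ))⁻¹ :=
    ⟨_, rfl⟩
  have hc_mem : ∀ σ τ, c σ τ ∈ Subgroup.center (GL (Fin n) k) := by
    intro σ τ
    rw [← Matrix.ProjGenLinGroup.mk_eq_one, hc_def]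
    simp only [map_mul, map_inv, hs_r, mul_inv_eq_one]
  have hcu : ∀ σ τ, ∃ u : kˣ, GeneralLinearGroup.scalar (Fin n) u = c σ τ := by
    intro σ τ
    have := hc_mem σ τ
    rw [GeneralLinearGroup.center_eq_range_scalar] at this
    exact MonoidHom.mem_range.1 this
  obtain ⟨z, hz_def⟩ : ∃ z : Γ → Γ → k, z = fun σ τ => (c σ τ : Matrix (Fin n) (Fin n) k) i₀ i₀ :=
    ⟨_, rfl⟩
  have key : ∀ σ τ, (s σ : Matrix (Fin n) (Fin n) k) * (s τ : Matrix (Fin n) (Fin n) k) =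
      z σ τ • (s (σ * τ) : Matrix (Fin n) (Fin n) k) := by
    intro σ τ
    obtain ⟨u, hu⟩ := hcu σ τ
    have hzu : z σ τ = (u : k) := by
      simp only [hz_def, ← hu, GeneralLinearGroup.coe_scalar, scalar_apply, diagonal_apply_eq]
    have hmul : s σ * s τ = c σ τ * s (σ * τ) := by
      simp only [hc_def, inv_mul_cancel_right]
    have hmul' := congrArg (fun A : GL (Fin n) k => (A : Matrix (Fin n) (Fin n) k)) hmul
    simp only [Units.val_mul] at hmul'
    rw [hmul', ← hu, GeneralLinearGroup.coe_scalar, scalar_apply, hzu, smul_eq_diagonal_mul]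
  have hz_lc : IsLocallyConstant (Function.uncurry z) := by
    have h3 : IsLocallyConstant fun p : Γ × Γ => (s p.1, s p.2, s (p.1 * p.2)) :=
      (hs_lc.comp_continuous continuous_fst).prodMk
        ((hs_lc.comp_continuous continuous_snd).prodMk (hs_lc.comp_continuous continuous_mul))
    have heq : Function.uncurry z = (fun q : GL (Fin n) k × GL (Fin n) k × GL (Fin n) k =>
        ((q.1 * q.2.1 * q.2.2⁻¹ : GL (Fin n) k) : Matrix (Fin n) (Fin n) k) i₀ i₀) ∘
        fun p : Γ × Γ => (s p.1, s p.2, s (p.1 * p.2)) := by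
      funext p
      simp only [hz_def, hc_def, Function.uncurry, Function.comp_apply]
    rw [heq]
    exact h3.comp _
  have hz_pow : ∀ σ τ, z σ τ ^ n = 1 := by
    intro σ τ
    have h := congrArg Matrix.det (key σ τ)
    rw [det_mul, det_smul, hs_det, hs_det, hs_det, Fintype.card_fin, mul_one, mul_one] at h
    exact h.symm
  have hz_cocycle : ∀ σ τ υ, z σ τ * z (σ * τ) υ = z τ υ * z σ (τ * υ) := by
    intro σ τ υ
    have h1 : (s σ : Matrix (Fin n) (Fin n) k) * (s τ : Matrix (Fin n) (Fin n) k) *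
        (s υ : Matrix (Fin n) (Fin n) k) =
        (z σ τ * z (σ * τ) υ) • (s (σ * τ * υ) : Matrix (Fin n) (Fin n) k) := by
      rw [key σ τ, smul_mul_assoc, key (σ * τ) υ, smul_smul]
    have h2 : (s σ : Matrix (Fin n) (Fin n) k) * ((s τ : Matrix (Fin n) (Fin n) k) *
        (s υ : Matrix (Fin n) (Fin n) k)) =
        (z τ υ * z σ (τ * υ)) • (s (σ * (τ * υ)) : Matrix (Fin n) (Fin n) k) := by
      rw [key τ υ, mul_smul_comm, key σ (τ * υ), smul_smul]
    rw [mul_assoc (s σ : Matrix (Fin n) (Fin n) k), h2, ← mul_assoc σ τ υ] at h1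
    exact (smul_left_injective k (hS_ne (σ * τ * υ)) h1).symm
  -- Step 4: the hypothesis kills the obstruction class.
  obtain ⟨b, hb, hb0, hbz⟩ := hH2 z hz_lc hz_pow hz_cocycle
  have hz0 : ∀ σ τ, z σ τ ≠ 0 := fun σ τ h0 => by
    have := hz_pow σ τ
    rw [h0, zero_pow hn.ne'] at this
    exact zero_ne_one this
  have hcoef : ∀ σ τ, (b σ)⁻¹ * (b τ)⁻¹ * z σ τ = (b (σ * τ))⁻¹ := by
    intro σ τ
    rw [← mul_inv, ← hbz σ τ, mul_inv, mul_comm (z σ τ)⁻¹, mul_assoc, inv_mul_cancel₀ (hz0 σ τ),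
      mul_one]
  -- Step 5: the twisted lift `W = b⁻¹ s` is a locally constant homomorphism.
  obtain ⟨tw, htw_def⟩ : ∃ tw : k × GL (Fin n) k → GL (Fin n) k,
      tw = fun p => if h : p.1 = 0 then p.2
        else GeneralLinearGroup.scalar (Fin n) (Units.mk0 p.1 h)⁻¹ * p.2 := ⟨_, rfl⟩
  obtain ⟨w, hw_def⟩ : ∃ w : Γ → GL (Fin n) k,
      w = fun σ => GeneralLinearGroup.scalar (Fin n) (Units.mk0 (b σ) (hb0 σ))⁻¹ * s σ :=
    ⟨_, rfl⟩
  have hw_eq : w = tw ∘ fun σ => (b σ, s σ) := by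
    funext σ
    simp only [hw_def, htw_def, Function.comp_apply, dif_neg (hb0 σ)]
  have hw_lc : IsLocallyConstant w := by
    rw [hw_eq]
    exact (hb.prodMk hs_lc).comp tw
  have hw_val : ∀ σ, (w σ : Matrix (Fin n) (Fin n) k) =
      (b σ)⁻¹ • (s σ : Matrix (Fin n) (Fin n) k) := by
    intro σ
    simp only [hw_def, Units.val_mul, GeneralLinearGroup.coe_scalar, Units.val_inv_eq_inv_val,
      Units.val_mk0, scalar_apply, ← smul_eq_diagonal_mul]
  have hw_mul : ∀ σ τ, w (σ * τ) = w σ * w τ := by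
    intro σ τ
    ext1
    rw [Units.val_mul, hw_val, hw_val, hw_val, smul_mul_assoc, mul_smul_comm, smul_smul, key σ τ,
      smul_smul, hcoef]
  have hw_r : ∀ σ, Matrix.ProjGenLinGroup.mk (w σ) = r σ := by
    intro σ
    simp only [hw_def]
    rw [map_mul, Matrix.ProjGenLinGroup.mk_scalar, one_mul, hs_r]
  exact ⟨⟨MonoidHom.mk' w hw_mul, hw_lc.continuous⟩, hw_lc, hw_r⟩

end DiscreteReduction

/-! ### `Tate_projectiveLifting` from Tate's theorem in `ℚ/ℤ`-cochain form -/

section Rat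

/-- **`Tate_projectiveLifting` from Tate's vanishing theorem (Serre, Durham §6.1, Corollary to
Theorem 4, as deduced from Theorem 4).**  *If* `H²(G_ℚ, ℚ/ℤ) = 0` in the concrete cochain sense
that every locally constant `2`-cocycle `G_ℚ × G_ℚ → ℚ/ℤ = AddCircle (1 : ℚ)` (trivial action)
is the coboundary of a locally constant cochain — Theorem 4 (Tate) for `K = ℚ`, §6.5, global
class field theory, not available in Mathlib or in this tree, and literally the hypothesis
under which `Patrikis2019_exists_lift_of_H2_addCircle` derives the `ℓ`-adic avatar — then every
projective representation `ρ̃ : G_ℚ → PGL_n(k)` with open kernel over an algebraically closed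
field `k` (any characteristic, discrete topology) has a continuous lifting
(`twoCocycle_split_of_addCircle_of_isLocallyConstant` +
`exists_continuousMonoidHom_lift_of_twoCocycle_discrete`).  This is the printed deduction
"Theorem 4 ⟹ Corollary", complete except for Theorem 4 itself.
[cite: SerreDurham1977, §6.1 Thm. 4 (Tate) and Corollary; §6.5] -/
theorem Tate_projectiveLifting_of_H2_addCircle
    (hTate : ∀ f : absoluteGaloisGroup ℚ → absoluteGaloisGroup ℚ → AddCircle (1 : ℚ),
      IsLocallyConstant (Function.uncurry f) →
      (∀ σ τ υ, f σ τ + f (σ * τ) υ = f τ υ + f σ (τ * υ)) →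
      ∃ b : absoluteGaloisGroup ℚ → AddCircle (1 : ℚ), IsLocallyConstant b ∧
        ∀ σ τ, f σ τ + b (σ * τ) = b σ + b τ) :
    Tate_projectiveLifting := by
  intro n k _ _ _ _ ρt hopen
  rcases Nat.eq_zero_or_pos n with hn | hn
  · subst hn
    refine ⟨1, fun σ => ?_⟩
    obtain ⟨g, hg⟩ := Matrix.ProjGenLinGroup.mk_surjective (ρt σ)
    rw [← hg, Subsingleton.elim g ((1 : FramedGaloisRep ℚ k 0) σ)]
  · obtain ⟨W, -, hW⟩ := exists_continuousMonoidHom_lift_of_twoCocycle_discrete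
      (fun z hz hzn hzz => twoCocycle_split_of_addCircle_of_isLocallyConstant hn hTate z hz hzn hzz)
      ρt hopen
    exact ⟨W, hW⟩

end Rat

/-!
## Converse bookkeeping: Tate's theorem in cochain form from the `ℓ`-adic lifting theorem

The rest of this file derives the hypothesis of `Tate_projectiveLifting_of_H2_addCircle` — for
every number field `F` — from the named fact `Patrikis2019_exists_lift_projective` (i) of
`ProjectiveLifting.lean` (the `ℓ`-adic avatar of Tate's lifting theorem), so that
`Tate_projectiveLifting` follows from that fact (`Tate_projectiveLifting_of_Patrikis2019`).  This is
the standard converse "every class in `H²(Γ_F, ℚ/ℤ)` is the obstruction class of a projective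
representation" (twisted regular representation of the finite central extension it defines),
followed by the remark that a continuous `ℚ̄_ℓˣ`-valued splitting of a finite-order cocycle has
absolute value `1` and can be reduced modulo the maximal ideal of `ℤ̄_ℓ`, where everything is
torsion of order prime to `ℓ` (choose `ℓ` prime to the order of the class).
-/

/-! ### Locally constant functions on compact groups factor through finite quotients -/

section UniformlyLocallyConstant

open Filter Topology
open scoped Pointwise

variable {G : Type*} [Group G] [TopologicalSpace G] [IsTopologicalGroup G] [CompactSpace G]

/-- A locally constant function on a compact group is *uniformly* locally constant: it is
invariant under right translation by a neighbourhood of `1`. [folklore] -/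
theorem exists_nhds_one_forall_mul_eq_of_isLocallyConstant {Y : Type*} {F : G → Y}
    (hF : IsLocallyConstant F) : ∃ V ∈ 𝓝 (1 : G), ∀ g, ∀ v ∈ V, F (g * v) = F g := by
  classical
  have hfib : ∀ y : Y, ∃ V ∈ 𝓝 (1 : G), F ⁻¹' {y} * V ⊆ F ⁻¹' {y} := fun y =>
    compact_open_separated_mul_right (hF.isClosed_fiber y).isCompact (hF.isOpen_fiber y)
      subset_rfl
  choose V hV hVsub using hfib
  have hfin : (Set.range F).Finite := hF.range_finite
  refine ⟨⋂ y ∈ hfin.toFinset, V y, (Filter.biInter_finset_mem _).2 fun y _ => hV y, ?_⟩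
  intro g v hv
  have hvy : v ∈ V (F g) :=
    Set.mem_iInter₂.1 hv (F g) (by rw [Set.Finite.mem_toFinset]; exact ⟨g, rfl⟩)
  have hmem : g * v ∈ F ⁻¹' {F g} := hVsub (F g) (Set.mul_mem_mul rfl hvy)
  exact hmem

variable [TotallyDisconnectedSpace G]

/-- A locally constant function on a profinite group is constant on the cosets of an open normal
subgroup. [folklore] -/
theorem exists_openNormalSubgroup_forall_mul_eq_of_isLocallyConstant {Y : Type*} {F : G → Y}
    (hF : IsLocallyConstant F) : ∃ N : OpenNormalSubgroup G, ∀ g, ∀ n ∈ N, F (g * n) = F g := by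
  obtain ⟨V, hV, hVF⟩ := exists_nhds_one_forall_mul_eq_of_isLocallyConstant hF
  obtain ⟨N, hN⟩ := ProfiniteGrp.exist_openNormalSubgroup_sub_open_nhds_of_one isOpen_interior
    (mem_interior_iff_mem_nhds.2 hV)
  exact ⟨N, fun g n hn => hVF g n (interior_subset (hN hn))⟩

/-- A locally constant function of two variables on a profinite group is constant on the cosets
of an open normal subgroup in each variable. [folklore] -/
theorem exists_openNormalSubgroup_forall_mul_eq_of_isLocallyConstant₂ {Y : Type*}
    {F : G → G → Y} (hF : IsLocallyConstant (Function.uncurry F)) :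
    ∃ N : OpenNormalSubgroup G, ∀ σ τ, ∀ n₁ ∈ N, ∀ n₂ ∈ N, F (σ * n₁) (τ * n₂) = F σ τ := by
  obtain ⟨V, hV, hVF⟩ := exists_nhds_one_forall_mul_eq_of_isLocallyConstant (G := G × G) hF
  obtain ⟨V₁, hV₁, V₂, hV₂, hsub⟩ := mem_nhds_prod_iff.1 hV
  obtain ⟨N, hN⟩ := ProfiniteGrp.exist_openNormalSubgroup_sub_open_nhds_of_one (G := G)
    isOpen_interior (mem_interior_iff_mem_nhds.2 (Filter.inter_mem hV₁ hV₂))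
  refine ⟨N, fun σ τ n₁ hn₁ n₂ hn₂ => ?_⟩
  have h1 := interior_subset (hN hn₁)
  have h2 := interior_subset (hN hn₂)
  exact hVF (σ, τ) (n₁, n₂) (hsub (Set.mk_mem_prod h1.1 h2.2))

end UniformlyLocallyConstant

/-! ### Continuous multiplicative positive functions on compact groups are trivial -/

section NormOne

/-- A continuous function `φ > 0` on a compact group with `φ(στ) = φ(σ) φ(τ)` is identically `1`
(its image is a compact subgroup of `ℝ_{>0}`). [folklore] -/
theorem eq_one_of_continuous_of_map_mul {Γ : Type*} [Group Γ] [TopologicalSpace Γ]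
    [CompactSpace Γ] {φ : Γ → ℝ} (hφ : Continuous φ) (hpos : ∀ σ, 0 < φ σ)
    (hmul : ∀ σ τ, φ (σ * τ) = φ σ * φ τ) (σ : Γ) : φ σ = 1 := by
  have h1 : φ 1 = 1 := by
    have h := hmul 1 1
    rw [mul_one] at h
    exact (mul_eq_left₀ (hpos 1).ne').1 h.symm
  have hinv : ∀ τ, φ τ⁻¹ = (φ τ)⁻¹ := by
    intro τ
    have h := hmul τ τ⁻¹
    rw [mul_inv_cancel, h1] at h
    exact (eq_inv_of_mul_eq_one_right h.symm)
  have hpow : ∀ τ (j : ℕ), φ (τ ^ j) = φ τ ^ j := by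
    intro τ j
    induction j with
    | zero => rw [pow_zero, pow_zero, h1]
    | succ j ih => rw [pow_succ, hmul, ih, pow_succ]
  obtain ⟨x, -, hx⟩ := isCompact_univ.exists_isMaxOn Set.univ_nonempty hφ.continuousOn
  have hbig : ∀ τ, ¬ 1 < φ τ := by
    intro τ hτ
    obtain ⟨j, hj⟩ := pow_unbounded_of_one_lt (φ x) hτ
    have hle : φ (τ ^ j) ≤ φ x := hx (Set.mem_univ _)
    rw [hpow] at hle
    exact absurd (hj.trans_le hle) (lt_irrefl _)
  rcases lt_trichotomy (φ σ) 1 with hlt | heq | hgt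
  · exfalso
    refine hbig σ⁻¹ ?_
    rw [hinv]
    exact one_lt_inv_iff₀.2 ⟨hpos σ, hlt⟩
  · exact heq
  · exact absurd hgt (hbig σ)

end NormOne

/-! ### Finite cyclic groups embed into `ℚ/ℤ` -/

section CyclicToAddCircle

/-- A finite cyclic group admits an injective homomorphism into `ℚ/ℤ = AddCircle (1 : ℚ)`
(`η^u ↦ u / ord(η)`). [folklore] -/
theorem exists_injective_mulHom_addCircle (T : Type*) [Group T] [Finite T] [IsCyclic T] :
    ∃ lam : T → AddCircle (1 : ℚ), (∀ x y, lam (x * y) = lam x + lam y) ∧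
      Function.Injective lam := by
  obtain ⟨η, hη⟩ := IsCyclic.exists_zpow_surjective (G := T)
  set t : ℕ := orderOf η with ht_def
  have ht : 0 < t := orderOf_pos η
  choose dl hdl' using hη
  have hdl : ∀ b, η ^ dl b = b := hdl'
  have hdvd : ∀ {a b : ℤ}, η ^ a = η ^ b → (t : ℤ) ∣ a - b := by
    intro a b hab
    rw [ht_def, orderOf_dvd_iff_zpow_eq_one, zpow_sub, hab, mul_inv_cancel]
  refine ⟨fun x => (((dl x : ℚ) / t : ℚ) : AddCircle (1 : ℚ)), fun x y => ?_, fun x y hxy => ?_⟩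
  · rw [← QuotientAddGroup.mk_add, ← add_div]
    have key : (t : ℤ) ∣ dl (x * y) - (dl x + dl y) :=
      hdvd (by rw [zpow_add, hdl, hdl, hdl])
    have h := (addCircle_intCast_div_eq_intCast_div_iff ht.ne' _ _).2 key
    push_cast at h
    exact h
  · have h := (addCircle_intCast_div_eq_intCast_div_iff ht.ne' _ _).1 hxy
    rw [ht_def, orderOf_dvd_iff_zpow_eq_one, zpow_sub, mul_inv_eq_one, hdl, hdl] at h
    exact h

/-- An `N`-torsion element `x₀` of `ℚ/ℤ` such that `c • x₀ = 0` forces `N ∣ c` has exact order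
`N`, hence is `a/N` with `a` invertible modulo `N`. [folklore] -/
theorem addCircle_exists_eq_div_and_inverse {N : ℕ} (hN : 0 < N) {x₀ : AddCircle (1 : ℚ)}
    (hx₀ : N • x₀ = 0) (hord : ∀ c : ℕ, 0 < c → c • x₀ = 0 → N ∣ c) :
    ∃ a a' : ℤ, x₀ = (((a : ℚ) / N : ℚ) : AddCircle (1 : ℚ)) ∧ (N : ℤ) ∣ a' * a - 1 := by
  obtain ⟨a, ha⟩ := addCircle_exists_eq_intCast_div_of_nsmul_eq_zero hN.ne' hx₀
  -- `gcd(a, N) = 1`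
  set c : ℕ := Int.gcd a N with hc_def
  have hca : (c : ℤ) ∣ a := Int.gcd_dvd_left a N
  have hcN' : (c : ℤ) ∣ (N : ℤ) := Int.gcd_dvd_right a N
  have hcN : c ∣ N := Int.natCast_dvd_natCast.1 hcN'
  have hc0 : 0 < c := Nat.pos_of_dvd_of_pos hcN hN
  obtain ⟨a₁, ha₁⟩ := hca
  set N₁ : ℕ := N / c with hN₁_def
  have hNc : c * N₁ = N := Nat.mul_div_cancel' hcN
  have hN₁0 : 0 < N₁ := Nat.pos_of_mul_pos_left (hNc.symm ▸ hN)
  have hN₁x : N₁ • x₀ = 0 := by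
    rw [ha, ← QuotientAddGroup.mk_nsmul, QuotientAddGroup.eq_zero_iff,
      AddSubgroup.mem_zmultiples_iff]
    refine ⟨a₁, ?_⟩
    rw [zsmul_eq_mul, mul_one, nsmul_eq_mul, ha₁]
    have hN' : (N : ℚ) ≠ 0 := Nat.cast_ne_zero.2 hN.ne'
    have hNq : ((c : ℤ) : ℚ) * (N₁ : ℚ) = N := by exact_mod_cast hNc
    field_simp
    rw [← hNq]
    push_cast
    ring
  have hdvd : N ∣ N₁ := hord N₁ hN₁0 hN₁x
  have hle : N ≤ N₁ := Nat.le_of_dvd hN₁0 hdvd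
  have hc1 : c = 1 := by
    have h1 : N₁ ≤ N := Nat.div_le_self N c
    have h2 : N / c = N := le_antisymm h1 hle
    rcases Nat.div_eq_self.1 h2 with h | h
    · exact absurd h hN.ne'
    · exact h
  have hcop : IsCoprime a (N : ℤ) := Int.isCoprime_iff_gcd_eq_one.2 hc1
  obtain ⟨u, v, huv⟩ := hcop
  refine ⟨a, u, ha, ⟨-v, ?_⟩⟩
  linear_combination huv

end CyclicToAddCircle

/-! ### The twisted regular projective representation of a finite `2`-cocycle -/

section TwistedRegular

variable {G : Type*} [Group G] [Finite G] {K : Type*} [Field K]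

/-- **Every `2`-cocycle is an obstruction class.**  For a finite group `G` and a normalised
`Kˣ`-valued `2`-cocycle `z` on `G` (trivial action) there is a "twisted regular" projective
representation: invertible matrices `S(h)`, `h ∈ G`, of size `|G|` with
`S(h) S(k) = z(h,k) S(hk)` — namely `S(h)_{g,g'} = [g' = gh] z(g,h)`, the action of `h` on the
twisted group algebra. [folklore] -/
theorem exists_twistedRegular (z : G → G → Kˣ)
    (hz : ∀ g h k, z g h * z (g * h) k = z h k * z g (h * k)) (hz1 : ∀ g, z g 1 = 1) :
    ∃ (m : ℕ) (S : G → GL (Fin m) K), 0 < m ∧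
      ∀ h k, S h * S k = GeneralLinearGroup.scalar (Fin m) (z h k) * S (h * k) := by
  classical
  haveI := Fintype.ofFinite G
  obtain ⟨T, hT_def⟩ : ∃ T : G → Matrix G G K,
      T = fun h => Matrix.of fun g g' => if g' = g * h then (z g h : K) else 0 := ⟨_, rfl⟩
  have hT : ∀ h k, T h * T k = (z h k : K) • T (h * k) := by
    intro h k
    ext g g''
    rw [Matrix.mul_apply, Finset.sum_eq_single (g * h), Matrix.smul_apply, smul_eq_mul]
    · simp only [hT_def, Matrix.of_apply, if_true]
      by_cases hg : g'' = g * h * k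
      · subst hg
        rw [if_pos rfl, if_pos (mul_assoc g h k)]
        have h1 := congrArg (fun w : Kˣ => (w : K)) (hz g h k)
        simp only [Units.val_mul] at h1
        exact h1
      · have hg' : ¬ g'' = g * (h * k) := fun h' => hg (by rw [h', mul_assoc])
        rw [if_neg hg, if_neg hg', mul_zero, mul_zero]
    · intro g' _ hg'
      simp only [hT_def, Matrix.of_apply, if_neg hg', zero_mul]
    · intro habs
      exact absurd (Finset.mem_univ _) habs
  have hT1 : T 1 = 1 := by
    ext g g'
    simp only [hT_def, Matrix.of_apply, mul_one, hz1, Units.val_one, Matrix.one_apply]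
    by_cases hgg : g = g'
    · rw [if_pos hgg.symm, if_pos hgg]
    · rw [if_neg (Ne.symm hgg), if_neg hgg]
  set e : G ≃ Fin (Fintype.card G) := Fintype.equivFin G
  set φ := Matrix.reindexAlgEquiv K K e with hφ_def
  have hz0 : ∀ h k, (z h k : K) ≠ 0 := fun h k => (z h k).ne_zero
  have hinv : ∀ h, φ (T h) * ((z h h⁻¹ : K)⁻¹ • φ (T h⁻¹)) = 1 := by
    intro h
    rw [mul_smul_comm, ← map_mul, hT, mul_inv_cancel, hT1, map_smul, map_one, smul_smul,
      inv_mul_cancel₀ (hz0 _ _), one_smul]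
  refine ⟨Fintype.card G, fun h => ⟨φ (T h), (z h h⁻¹ : K)⁻¹ • φ (T h⁻¹), hinv h,
    mul_eq_one_comm.1 (hinv h)⟩, Fintype.card_pos, fun h k => ?_⟩
  ext1
  simp only [Units.val_mul, GeneralLinearGroup.coe_scalar, scalar_apply]
  rw [← map_mul, hT, map_smul, smul_eq_diagonal_mul]

end TwistedRegular

/-! ### Reduction of unit cochains of `ℚ̄_ℓ` modulo the maximal ideal -/

section Residue

open NNReal

/-- In a local domain whose residue field has `N₀ ≠ 0`, an `N₀`-th root of unity with trivial
residue is trivial (`0 = 1 + η + ⋯ + η^{N₀-1} ≡ N₀`). [folklore] -/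
theorem eq_one_of_pow_eq_one_of_residue_eq_one {O : Type*} [CommRing O] [IsDomain O]
    [IsLocalRing O] {N₀ : ℕ} (hN₀ : (N₀ : IsLocalRing.ResidueField O) ≠ 0) {η : O}
    (hηN : η ^ N₀ = 1) (hres : IsLocalRing.residue O η = 1) : η = 1 := by
  by_contra hne
  have hgeom : (∑ i ∈ Finset.range N₀, η ^ i) * (η - 1) = 0 := by
    rw [geom_sum_mul, hηN, sub_self]
  have hsum : ∑ i ∈ Finset.range N₀, η ^ i = 0 :=
    (mul_eq_zero.1 hgeom).resolve_right (sub_ne_zero.2 hne)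
  have h := congrArg (IsLocalRing.residue O) hsum
  rw [map_sum, map_zero] at h
  simp only [map_pow, hres, one_pow, Finset.sum_const, Finset.card_range, nsmul_eq_mul,
    mul_one] at h
  exact hN₀ h

/-- **Reduction modulo `𝔪`.**  Let `u : Γ → ℚ̄_ℓˣ` be continuous of absolute value `1` with
`u(στ) = u(σ) u(τ) ξ^{j(σ,τ)}` for a primitive `N₀`-th root of unity `ξ`, `ℓ ∤ N₀`.  Reducing
modulo the maximal ideal of `ℤ̄_ℓ = 𝒪[ℚ̄_ℓ]` gives a *locally constant* `β : Γ → 𝓀ˣ` and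
`ξ' ∈ 𝓀ˣ` still of exact order `N₀` (the residue characteristic `ℓ` is prime to `N₀`) with
`β(στ) = β(σ) β(τ) ξ'^{j(σ,τ)}`. [folklore] -/
theorem PadicAlgCl.exists_residue_cochain (ℓ : ℕ) [Fact ℓ.Prime] {Γ : Type*} [Group Γ]
    [TopologicalSpace Γ] {N₀ : ℕ} (hN₀ : 0 < N₀) (hℓ : ¬ ℓ ∣ N₀) {ξ : PadicAlgCl ℓ}
    (hξ : IsPrimitiveRoot ξ N₀) (j : Γ → Γ → ℕ) {u : Γ → (PadicAlgCl ℓ)ˣ}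
    (hu : Continuous fun σ => (u σ : PadicAlgCl ℓ)) (hnorm : ∀ σ, ‖(u σ : PadicAlgCl ℓ)‖ = 1)
    (humul : ∀ σ τ, (u (σ * τ) : PadicAlgCl ℓ) = u σ * u τ * ξ ^ j σ τ) :
    ∃ (β : Γ → (IsLocalRing.ResidueField (Valued.integer (PadicAlgCl ℓ)))ˣ)
      (ξ' : (IsLocalRing.ResidueField (Valued.integer (PadicAlgCl ℓ)))ˣ),
      IsLocallyConstant β ∧ ξ' ^ N₀ = 1 ∧ (∀ i : ℕ, ξ' ^ i = 1 → N₀ ∣ i) ∧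
      ∀ σ τ, β (σ * τ) = β σ * β τ * ξ' ^ j σ τ := by
  classical
  have hℓp : ℓ.Prime := Fact.out
  -- the valuation ring `O`, its residue map, membership and units
  have hmemO : ∀ {x : PadicAlgCl ℓ}, ‖x‖ ≤ 1 → x ∈ Valued.integer (PadicAlgCl ℓ) := by
    intro x hx
    rw [Valuation.mem_integer_iff, PadicAlgCl.valuation_def]
    exact_mod_cast hx
  have hunitO : ∀ {x : PadicAlgCl ℓ} (hx : ‖x‖ = 1),
      IsUnit (⟨x, hmemO hx.le⟩ : Valued.integer (PadicAlgCl ℓ)) := by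
    intro x hx
    rw [Valuation.Integers.isUnit_iff_valuation_eq_one (Valuation.integer.integers _)]
    show Valued.v x = 1
    rw [PadicAlgCl.valuation_def]
    exact NNReal.eq (by rw [coe_nnnorm, NNReal.coe_one]; exact hx)
  have hlt1 : ∀ {y : Valued.integer (PadicAlgCl ℓ)}, ‖(y : PadicAlgCl ℓ)‖ < 1 →
      y ∈ IsLocalRing.maximalIdeal (Valued.integer (PadicAlgCl ℓ)) := by
    intro y hy
    rw [IsLocalRing.mem_maximalIdeal, mem_nonunits_iff,
      Valuation.Integer.not_isUnit_iff_valuation_lt_one, PadicAlgCl.valuation_def]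
    exact_mod_cast hy
  -- residue characteristic
  have hℓmem : ((ℓ : ℕ) : Valued.integer (PadicAlgCl ℓ)) ∈
      IsLocalRing.maximalIdeal (Valued.integer (PadicAlgCl ℓ)) := by
    apply hlt1
    rw [show (((ℓ : ℕ) : Valued.integer (PadicAlgCl ℓ)) : PadicAlgCl ℓ) = (ℓ : PadicAlgCl ℓ) from
      rfl, ← PadicAlgCl.valuation_coe, PadicAlgCl.valuation_p]
    have h1 : (1 : ℝ≥0) < ℓ := by exact_mod_cast hℓp.one_lt
    have h2 : (1 : ℝ≥0) / ℓ < 1 := (div_lt_one (zero_lt_one.trans h1)).2 h1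
    exact_mod_cast h2
  have hℓκ : ((ℓ : ℕ) : IsLocalRing.ResidueField (Valued.integer (PadicAlgCl ℓ))) = 0 := by
    rw [← map_natCast (IsLocalRing.residue (Valued.integer (PadicAlgCl ℓ))),
      IsLocalRing.residue_eq_zero_iff]
    exact hℓmem
  haveI hchar : CharP (IsLocalRing.ResidueField (Valued.integer (PadicAlgCl ℓ))) ℓ :=
    (CharP.charP_iff_prime_eq_zero hℓp).2 hℓκ
  have hN₀κ : (N₀ : IsLocalRing.ResidueField (Valued.integer (PadicAlgCl ℓ))) ≠ 0 := fun h =>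
    hℓ ((CharP.cast_eq_zero_iff _ ℓ N₀).1 h)
  -- the unit cochain in `O` and its reduction
  have hξ1 : ‖ξ‖ = 1 := by
    have h : ‖ξ‖ ^ N₀ = 1 := by rw [← norm_pow, hξ.pow_eq_one, norm_one]
    exact (pow_eq_one_iff_of_nonneg (norm_nonneg ξ) hN₀.ne').1 h
  set ξO : (Valued.integer (PadicAlgCl ℓ))ˣ := (hunitO hξ1).unit with hξO_def
  set uO : Γ → (Valued.integer (PadicAlgCl ℓ))ˣ := fun σ => (hunitO (hnorm σ)).unit with huO_def
  have hξO_val : (((ξO : Valued.integer (PadicAlgCl ℓ)) : PadicAlgCl ℓ)) = ξ := by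
    rw [hξO_def, IsUnit.unit_spec]
  have huO_val : ∀ σ, (((uO σ : Valued.integer (PadicAlgCl ℓ)) : PadicAlgCl ℓ)) = u σ := by
    intro σ
    rw [huO_def, IsUnit.unit_spec]
  have huO_mul : ∀ σ τ, uO (σ * τ) = uO σ * uO τ * ξO ^ j σ τ := by
    intro σ τ
    ext
    simp only [Units.val_mul, Units.val_pow_eq_pow_val, Subring.coe_mul, SubmonoidClass.coe_pow,
      huO_val]
    rw [hξO_val]
    exact humul σ τ
  have hξON : ξO ^ N₀ = 1 := by
    ext
    simp only [Units.val_pow_eq_pow_val, SubmonoidClass.coe_pow, Units.val_one,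
      OneMemClass.coe_one]
    rw [hξO_val, hξ.pow_eq_one]
  set res := IsLocalRing.residue (Valued.integer (PadicAlgCl ℓ)) with hres_def
  set β : Γ → (IsLocalRing.ResidueField (Valued.integer (PadicAlgCl ℓ)))ˣ :=
    fun σ => Units.map (res : _ →* _) (uO σ) with hβ_def
  set ξ' : (IsLocalRing.ResidueField (Valued.integer (PadicAlgCl ℓ)))ˣ :=
    Units.map (res : _ →* _) ξO with hξ'_def
  refine ⟨β, ξ', ?_, ?_, ?_, ?_⟩
  · -- locally constant
    rw [IsLocallyConstant.iff_exists_open]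
    intro σ₀
    refine ⟨{σ | ‖(u σ : PadicAlgCl ℓ) - u σ₀‖ < 1},
      isOpen_lt (hu.sub continuous_const).norm continuous_const, by simp, fun σ hσ => ?_⟩
    apply Units.ext
    simp only [hβ_def, Units.coe_map, MonoidHom.coe_coe]
    rw [← sub_eq_zero, ← map_sub, hres_def, IsLocalRing.residue_eq_zero_iff]
    apply hlt1
    rw [show (((uO σ : Valued.integer (PadicAlgCl ℓ)) - (uO σ₀ : Valued.integer (PadicAlgCl ℓ)) :
        Valued.integer (PadicAlgCl ℓ)) : PadicAlgCl ℓ) = u σ - u σ₀ by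
      rw [← huO_val σ, ← huO_val σ₀]; rfl]
    exact hσ
  · rw [hξ'_def, ← map_pow, hξON, map_one]
  · intro i hi
    have h1 : res ((ξO : Valued.integer (PadicAlgCl ℓ)) ^ i) = 1 := by
      have := congrArg (fun x : (IsLocalRing.ResidueField (Valued.integer (PadicAlgCl ℓ)))ˣ =>
        (x : IsLocalRing.ResidueField (Valued.integer (PadicAlgCl ℓ)))) hi
      simpa only [hξ'_def, ← map_pow, Units.coe_map, MonoidHom.coe_coe, Units.val_pow_eq_pow_val,
        Units.val_one] using this
    have h2 : ((ξO : Valued.integer (PadicAlgCl ℓ)) ^ i) ^ N₀ = 1 := by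
      rw [← pow_mul, mul_comm, pow_mul, ← Units.val_pow_eq_pow_val, hξON, Units.val_one, one_pow]
    have h3 := eq_one_of_pow_eq_one_of_residue_eq_one hN₀κ h2 h1
    have h4 : ξ ^ i = 1 := by
      have := congrArg (fun x : Valued.integer (PadicAlgCl ℓ) => (x : PadicAlgCl ℓ)) h3
      simpa only [SubmonoidClass.coe_pow, hξO_val, OneMemClass.coe_one] using this
    exact (hξ.pow_eq_one_iff_dvd i).1 h4
  · intro σ τ
    simp only [hβ_def, hξ'_def, huO_mul, map_mul, map_pow]

end Residue

/-! ### From a reduced unit cochain to a `ℚ/ℤ`-valued splitting -/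

section UnitCochain

/-- **Killing a torsion class by a torsion cochain.**  Let `β : Γ → Rˣ` be locally constant on a
compact group with `β(στ) = β(σ) β(τ) ξ^{j(σ,τ)}`, where `ξ` has exact order `N₀` (`ξ^{N₀} = 1`
and `ξ^i = 1 ⇒ N₀ ∣ i`).  Then the `ℚ/ℤ`-valued cocycle `j/N₀` is the coboundary of a locally
constant cochain.  Proof: modulo `μ_{N₀}` the map `β` is a homomorphism with finite image, so
`β` takes values in the finite cyclic group `μ_M(R)`, `M = t N₀`; embed `μ_M(R) ↪ ℚ/ℤ`
(`exists_injective_mulHom_addCircle`); the image of `ξ` is `a/N₀` with `a` invertible mod `N₀`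
(`addCircle_exists_eq_div_and_inverse`), and multiplying by an inverse `a'` of `a` gives the
splitting. [folklore] -/
theorem addCircle_split_of_unit_cochain {Γ : Type*} [Group Γ] [TopologicalSpace Γ]
    [CompactSpace Γ] {R : Type*} [CommRing R] [IsDomain R] {N₀ : ℕ} (hN₀ : 0 < N₀) {ξ : Rˣ}
    (hξN : ξ ^ N₀ = 1) (hξinj : ∀ i : ℕ, ξ ^ i = 1 → N₀ ∣ i) (j : Γ → Γ → ℕ) {β : Γ → Rˣ}
    (hβ : IsLocallyConstant β) (hβmul : ∀ σ τ, β (σ * τ) = β σ * β τ * ξ ^ j σ τ) :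
    ∃ b : Γ → AddCircle (1 : ℚ), IsLocallyConstant b ∧
      ∀ σ τ, (((j σ τ : ℚ) / N₀ : ℚ) : AddCircle (1 : ℚ)) + b (σ * τ) = b σ + b τ := by
  classical
  -- modulo `μ_{N₀}` the cochain `β` is a homomorphism with finite image
  have hξmem : ∀ i : ℕ, ξ ^ i ∈ rootsOfUnity N₀ R := fun i => by
    rw [mem_rootsOfUnity, ← pow_mul, mul_comm, pow_mul, hξN, one_pow]
  have hψmul : ∀ σ τ, (QuotientGroup.mk (β (σ * τ)) : Rˣ ⧸ rootsOfUnity N₀ R) =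
      QuotientGroup.mk (β σ) * QuotientGroup.mk (β τ) := by
    intro σ τ
    rw [hβmul, ← QuotientGroup.mk_mul, QuotientGroup.eq, _root_.mul_inv_rev, inv_mul_cancel_right]
    exact inv_mem (hξmem _)
  obtain ⟨ψ, hψ_def⟩ : ∃ ψ : Γ →* Rˣ ⧸ rootsOfUnity N₀ R,
      ψ = MonoidHom.mk' (fun σ => (QuotientGroup.mk (β σ) : Rˣ ⧸ rootsOfUnity N₀ R)) hψmul :=
    ⟨_, rfl⟩
  have hψ_apply : ∀ σ, ψ σ = QuotientGroup.mk (β σ) := fun σ => by rw [hψ_def]; rfl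
  have hψ_fin : (Set.range ψ).Finite := by
    refine (hβ.range_finite.image (QuotientGroup.mk : Rˣ → Rˣ ⧸ rootsOfUnity N₀ R)).subset ?_
    rintro _ ⟨σ, rfl⟩
    exact ⟨β σ, ⟨σ, rfl⟩, (hψ_apply σ).symm⟩
  haveI : Finite ψ.range := Set.finite_coe_iff.2 (by rw [MonoidHom.coe_range]; exact hψ_fin)
  set t : ℕ := Nat.card ψ.range with ht_def
  have ht : 0 < t := Nat.card_pos
  have hβt : ∀ σ, β σ ^ (t * N₀) = 1 := by
    intro σ
    have h1 : (⟨ψ σ, ⟨σ, rfl⟩⟩ : ψ.range) ^ t = 1 := pow_card_eq_one'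
    have h2 : ψ σ ^ t = 1 := by
      have := congrArg Subtype.val h1
      simpa using this
    have h3 : (QuotientGroup.mk (β σ ^ t) : Rˣ ⧸ rootsOfUnity N₀ R) = 1 := by
      rw [QuotientGroup.mk_pow, ← hψ_apply]
      exact h2
    rw [QuotientGroup.eq_one_iff, mem_rootsOfUnity] at h3
    rw [pow_mul]
    exact h3
  -- so `β` and `ξ` live in the finite cyclic group `μ_M(R)`, which embeds into `ℚ/ℤ`
  set M : ℕ := t * N₀ with hM_def
  haveI : NeZero M := ⟨(Nat.mul_pos ht hN₀).ne'⟩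
  have hβM : ∀ σ, β σ ∈ rootsOfUnity M R := fun σ => (mem_rootsOfUnity _ _).2 (hβt σ)
  have hξM : ξ ∈ rootsOfUnity M R := by
    rw [mem_rootsOfUnity, hM_def, mul_comm, pow_mul, hξN, one_pow]
  obtain ⟨lam, hlam_mul, hlam_inj⟩ := exists_injective_mulHom_addCircle (rootsOfUnity M R)
  have hlam_one : lam 1 = 0 := by
    have h := hlam_mul 1 1
    rw [mul_one] at h
    exact (left_eq_add.1 h)
  have hlam_pow : ∀ x (i : ℕ), lam (x ^ i) = i • lam x := by
    intro x i
    induction i with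
    | zero => rw [pow_zero, hlam_one, zero_nsmul]
    | succ i ih => rw [pow_succ, hlam_mul, ih, succ_nsmul]
  set x₀ : AddCircle (1 : ℚ) := lam ⟨ξ, hξM⟩ with hx₀_def
  have hξpow : ∀ i : ℕ, (⟨ξ, hξM⟩ : rootsOfUnity M R) ^ i = 1 ↔ ξ ^ i = 1 := by
    intro i
    rw [Subtype.ext_iff]
    simp
  have hx₀N : N₀ • x₀ = 0 := by
    rw [hx₀_def, ← hlam_pow, (hξpow N₀).2 hξN, hlam_one]
  have hx₀ord : ∀ c : ℕ, 0 < c → c • x₀ = 0 → N₀ ∣ c := by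
    intro c _ hc
    rw [hx₀_def, ← hlam_pow, ← hlam_one] at hc
    exact hξinj c ((hξpow c).1 (hlam_inj hc))
  obtain ⟨a, a', hx₀a, ha'⟩ := addCircle_exists_eq_div_and_inverse hN₀ hx₀N hx₀ord
  -- the splitting
  obtain ⟨gT, hgT_def⟩ : ∃ gT : Rˣ → AddCircle (1 : ℚ),
      gT = fun x => if hx : x ∈ rootsOfUnity M R then lam ⟨x, hx⟩ else 0 := ⟨_, rfl⟩
  obtain ⟨b', hb'_def⟩ : ∃ b' : Γ → AddCircle (1 : ℚ), b' = fun σ => lam ⟨β σ, hβM σ⟩ :=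
    ⟨_, rfl⟩
  have hb'_eq : b' = gT ∘ β := by
    funext σ
    simp only [hgT_def, hb'_def, Function.comp_apply, dif_pos (hβM σ)]
  have hb'_lc : IsLocallyConstant b' := by
    rw [hb'_eq]
    exact hβ.comp gT
  have hb'_mul : ∀ σ τ, b' (σ * τ) = b' σ + b' τ + j σ τ • x₀ := by
    intro σ τ
    have hT : (⟨β (σ * τ), hβM _⟩ : rootsOfUnity M R) =
        ⟨β σ, hβM σ⟩ * ⟨β τ, hβM τ⟩ * ⟨ξ, hξM⟩ ^ j σ τ :=
      Subtype.ext (by simp [hβmul σ τ])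
    simp only [hb'_def]
    rw [hT, hlam_mul, hlam_mul, hlam_pow]
  have hN₀q : (N₀ : ℚ) ≠ 0 := Nat.cast_ne_zero.2 hN₀.ne'
  have hjx₀ : ∀ σ τ, j σ τ • x₀ = a • ((((j σ τ : ℚ) / N₀ : ℚ)) : AddCircle (1 : ℚ)) := by
    intro σ τ
    rw [hx₀a, ← QuotientAddGroup.mk_nsmul, ← QuotientAddGroup.mk_zsmul]
    congr 1
    rw [nsmul_eq_mul, zsmul_eq_mul]
    ring
  obtain ⟨c, hc⟩ := ha'
  refine ⟨fun σ => -(a' • b' σ), hb'_lc.comp fun x => -(a' • x), fun σ τ => ?_⟩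
  have hN : (N₀ : ℤ) • ((((j σ τ : ℚ) / N₀ : ℚ)) : AddCircle (1 : ℚ)) = 0 := by
    rw [← QuotientAddGroup.mk_zsmul, QuotientAddGroup.eq_zero_iff, AddSubgroup.mem_zmultiples_iff]
    refine ⟨j σ τ, ?_⟩
    rw [zsmul_eq_mul, zsmul_eq_mul, mul_one]
    field_simp
    push_cast
    ring
  have hkey : (a' * a) • ((((j σ τ : ℚ) / N₀ : ℚ)) : AddCircle (1 : ℚ)) =
      (((j σ τ : ℚ) / N₀ : ℚ) : AddCircle (1 : ℚ)) := by
    rw [show a' * a = 1 + c * N₀ by linarith, add_zsmul, one_zsmul, mul_smul, hN, smul_zero,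
      add_zero]
  show (((j σ τ : ℚ) / N₀ : ℚ) : AddCircle (1 : ℚ)) + -(a' • b' (σ * τ)) =
    -(a' • b' σ) + -(a' • b' τ)
  rw [hb'_mul, hjx₀, smul_add, smul_add, smul_smul]
  nth_rewrite 1 [← hkey]
  abel

end UnitCochain

/-! ### Continuous splittings from the `ℓ`-adic lifting theorem -/

section FromPatrikis

/-- **Every finite `2`-cocycle splits continuously in `ℚ̄_ℓˣ`, granted the `ℓ`-adic lifting
theorem.**  Let `z` be a `ℚ̄_ℓˣ`-valued normalised `2`-cocycle on `Γ_F` factoring through the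
finite quotient by an open normal subgroup `N`.  Its twisted regular projective representation
`r : Γ_F → PGL_m(ℚ̄_ℓ)` (`exists_twistedRegular`) is continuous, so by
`Patrikis2019_exists_lift_projective` (i) it lifts to a continuous `W : Γ_F → GL_m(ℚ̄_ℓ)`;
comparing `W` with the monomial matrices `S` gives continuous scalars `u` with
`u(στ) = u(σ) u(τ) z(σ,τ)`, i.e. `z` is a continuous coboundary.
[cite: Patrikis2019, §2.1 (Tate's theorem and the Proposition = Conrad Prop. 5.3)] -/
theorem exists_unit_cochain_of_Patrikis2019 (hP : Patrikis2019_exists_lift_projective)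
    (F : Type) [Field F] [NumberField F] (ℓ : ℕ) [Fact ℓ.Prime]
    (N : OpenNormalSubgroup (absoluteGaloisGroup F))
    (z : absoluteGaloisGroup F → absoluteGaloisGroup F → (PadicAlgCl ℓ)ˣ)
    (hzN : ∀ σ τ, ∀ n₁ ∈ N, ∀ n₂ ∈ N, z (σ * n₁) (τ * n₂) = z σ τ)
    (hzc : ∀ σ τ υ, z σ τ * z (σ * τ) υ = z τ υ * z σ (τ * υ)) (hz1 : ∀ σ, z σ 1 = 1) :
    ∃ u : absoluteGaloisGroup F → (PadicAlgCl ℓ)ˣ, Continuous (fun σ => (u σ : PadicAlgCl ℓ)) ∧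
      ∀ σ τ, u (σ * τ) = u σ * u τ * z σ τ := by
  classical
  -- descend `z` to the finite group `Γ / N`
  set π : absoluteGaloisGroup F →* absoluteGaloisGroup F ⧸ N.toSubgroup :=
    QuotientGroup.mk' N.toSubgroup with hπ_def
  obtain ⟨zG, hzG_def⟩ : ∃ zG : (absoluteGaloisGroup F ⧸ N.toSubgroup) →
      (absoluteGaloisGroup F ⧸ N.toSubgroup) → (PadicAlgCl ℓ)ˣ,
      zG = fun x y => z (Quotient.out x) (Quotient.out y) := ⟨_, rfl⟩
  have hzG : ∀ σ τ, zG (π σ) (π τ) = z σ τ := by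
    intro σ τ
    obtain ⟨n₁, hn₁⟩ := QuotientGroup.mk_out_eq_mul N.toSubgroup σ
    obtain ⟨n₂, hn₂⟩ := QuotientGroup.mk_out_eq_mul N.toSubgroup τ
    rw [hzG_def]
    show z (Quotient.out (π σ)) (Quotient.out (π τ)) = z σ τ
    rw [hπ_def, QuotientGroup.mk'_apply, QuotientGroup.mk'_apply, hn₁, hn₂]
    exact hzN σ τ n₁ n₁.2 n₂ n₂.2
  have hzG_coc : ∀ x y w, zG x y * zG (x * y) w = zG y w * zG x (y * w) := by
    intro x y w
    obtain ⟨σ, rfl⟩ := QuotientGroup.mk'_surjective N.toSubgroup x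
    obtain ⟨τ, rfl⟩ := QuotientGroup.mk'_surjective N.toSubgroup y
    obtain ⟨υ, rfl⟩ := QuotientGroup.mk'_surjective N.toSubgroup w
    rw [← map_mul, ← map_mul, hzG, hzG, hzG, hzG]
    exact hzc σ τ υ
  have hzG_one : ∀ x, zG x 1 = 1 := by
    intro x
    obtain ⟨σ, rfl⟩ := QuotientGroup.mk'_surjective N.toSubgroup x
    rw [← map_one π, hzG]
    exact hz1 σ
  -- the twisted regular representation and the projective representation `r`
  obtain ⟨m, S, hm, hS⟩ := exists_twistedRegular zG hzG_coc hzG_one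
  haveI : Nonempty (Fin m) := ⟨⟨0, hm⟩⟩
  set i₀ : Fin m := ⟨0, hm⟩ with hi₀_def
  have hr₀mul : ∀ x y, (QuotientGroup.mk (S (x * y)) :
      GL (Fin m) (PadicAlgCl ℓ) ⧸ Subgroup.center (GL (Fin m) (PadicAlgCl ℓ))) =
        QuotientGroup.mk (S x) * QuotientGroup.mk (S y) := by
    intro x y
    rw [← QuotientGroup.mk_mul, hS, QuotientGroup.mk_mul,
      (QuotientGroup.eq_one_iff _).2 (scalar_mem_center' _), one_mul]
  set r₀ : (absoluteGaloisGroup F ⧸ N.toSubgroup) →*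
      GL (Fin m) (PadicAlgCl ℓ) ⧸ Subgroup.center (GL (Fin m) (PadicAlgCl ℓ)) :=
    MonoidHom.mk' (fun x => QuotientGroup.mk (S x)) hr₀mul with hr₀_def
  have hπ_lc : IsLocallyConstant π :=
    isLocallyConstant_of_isOpen_ker π (by
      rw [hπ_def, QuotientGroup.ker_mk']
      exact N.toOpenSubgroup.isOpen)
  have hr_lc : IsLocallyConstant (r₀ ∘ π) := hπ_lc.comp r₀
  set r : absoluteGaloisGroup F →ₜ*
      (GL (Fin m) (PadicAlgCl ℓ) ⧸ Subgroup.center (GL (Fin m) (PadicAlgCl ℓ))) :=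
    ⟨r₀.comp π, hr_lc.continuous⟩ with hr_def
  have hr_apply : ∀ σ, r σ = QuotientGroup.mk (S (π σ)) := fun σ => rfl
  -- the `ℓ`-adic lifting theorem
  obtain ⟨⟨W, hW⟩, -⟩ := hP F ℓ m r
  have hWσ : ∀ σ, ∃ uσ : (PadicAlgCl ℓ)ˣ,
      GeneralLinearGroup.scalar (Fin m) uσ = (S (π σ))⁻¹ * W σ := by
    intro σ
    have h := hW σ
    rw [hr_apply, eq_comm, QuotientGroup.eq, GeneralLinearGroup.center_eq_range_scalar] at h
    exact MonoidHom.mem_range.1 h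
  choose u hu using hWσ
  have hWu : ∀ σ, W σ = S (π σ) * GeneralLinearGroup.scalar (Fin m) (u σ) := fun σ => by
    rw [hu, mul_inv_cancel_left]
  have hcomm : ∀ (v : (PadicAlgCl ℓ)ˣ) (A : GL (Fin m) (PadicAlgCl ℓ)),
      GeneralLinearGroup.scalar (Fin m) v * A = A * GeneralLinearGroup.scalar (Fin m) v :=
    fun v A => (Subgroup.mem_center_iff.1 (scalar_mem_center' v) A).symm
  refine ⟨u, ?_, fun σ τ => ?_⟩
  · -- continuity of the scalars
    have h1 : IsLocallyConstant fun σ => (S (π σ))⁻¹ := hπ_lc.comp fun x => (S x)⁻¹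
    have h2 : Continuous fun σ => (S (π σ))⁻¹ * W σ := h1.continuous.mul W.continuous_toFun
    have h3 : Continuous fun σ => ((((S (π σ))⁻¹ * W σ : GL (Fin m) (PadicAlgCl ℓ)) :
        Matrix (Fin m) (Fin m) (PadicAlgCl ℓ)) i₀ i₀) :=
      (Units.continuous_val.comp h2).matrix_elem i₀ i₀
    refine h3.congr fun σ => ?_
    show (((S (π σ))⁻¹ * W σ : GL (Fin m) (PadicAlgCl ℓ)) : Matrix (Fin m) (Fin m) (PadicAlgCl ℓ))
      i₀ i₀ = (u σ : PadicAlgCl ℓ)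
    rw [← hu σ, GeneralLinearGroup.coe_scalar, scalar_apply, diagonal_apply_eq]
  · -- multiplicativity up to `z`
    have h : W (σ * τ) = W σ * W τ := map_mul W σ τ
    rw [hWu, hWu, hWu] at h
    rw [mul_assoc (S (π σ)), ← mul_assoc (GeneralLinearGroup.scalar (Fin m) (u σ)),
      hcomm (u σ) (S (π τ)), mul_assoc, ← mul_assoc (S (π σ)), hS, ← map_mul π] at h
    rw [hcomm (zG _ _), mul_assoc] at h
    have h' := mul_left_cancel h
    rw [← map_mul, ← map_mul] at h'
    have h'' := congrArg
      (fun A : GL (Fin m) (PadicAlgCl ℓ) => (A : Matrix (Fin m) (Fin m) (PadicAlgCl ℓ)) i₀ i₀) h'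
    simp only [GeneralLinearGroup.coe_scalar, scalar_apply, diagonal_apply_eq] at h''
    rw [hzG] at h''
    exact (Units.ext h'').trans (mul_comm _ _)

/-- **Tate's theorem in cochain form from the `ℓ`-adic lifting theorem.**  Granted the named fact
`Patrikis2019_exists_lift_projective` (i) (`ProjectiveLifting.lean`: every continuous
`Γ_F → PGL_n(ℚ̄_ℓ)` lifts continuously to `GL_n(ℚ̄_ℓ)`, for every number field `F`, prime `ℓ`
and `n` — the `ℓ`-adic avatar of Tate's theorem `H²(Γ_F, ℚ/ℤ) = 0`), every locally constant
`2`-cocycle `f : Γ_F × Γ_F → ℚ/ℤ` is the coboundary of a locally constant cochain.  Proof: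
normalise `f(1,1) = 0`; `f` factors through `Γ_F / N` for an open normal `N` and is killed by
some `N₀`; choose a prime `ℓ ∤ N₀` and a primitive `N₀`-th root of unity `ξ ∈ ℚ̄_ℓ`; the cocycle
`ξ^{N₀ f}` splits continuously in `ℚ̄_ℓˣ` (`exists_unit_cochain_of_Patrikis2019`), the splitting
has absolute value `1` (`eq_one_of_continuous_of_map_mul`), its reduction modulo `𝔪_{ℤ̄_ℓ}` is
locally constant and torsion of order prime to `ℓ` (`PadicAlgCl.exists_residue_cochain`), and
transporting back to `ℚ/ℤ` splits `f` (`addCircle_split_of_unit_cochain`).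
[cite: Patrikis2019, §2.1 Thm. (Tate) `H²(Γ_F, ℚ/ℤ) = 0` and Prop. (= Conrad Prop. 5.3)] -/
theorem twoCocycle_addCircle_split_of_Patrikis2019 (hP : Patrikis2019_exists_lift_projective)
    (F : Type) [Field F] [NumberField F]
    (f : absoluteGaloisGroup F → absoluteGaloisGroup F → AddCircle (1 : ℚ))
    (hf : IsLocallyConstant (Function.uncurry f))
    (hcoc : ∀ σ τ υ, f σ τ + f (σ * τ) υ = f τ υ + f σ (τ * υ)) :
    ∃ b : absoluteGaloisGroup F → AddCircle (1 : ℚ), IsLocallyConstant b ∧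
      ∀ σ τ, f σ τ + b (σ * τ) = b σ + b τ := by
  classical
  -- Step 0: we may assume `f 1 1 = 0`
  suffices hmain : ∀ f' : absoluteGaloisGroup F → absoluteGaloisGroup F → AddCircle (1 : ℚ),
      IsLocallyConstant (Function.uncurry f') →
      (∀ σ τ υ, f' σ τ + f' (σ * τ) υ = f' τ υ + f' σ (τ * υ)) → f' 1 1 = 0 →
      ∃ b : absoluteGaloisGroup F → AddCircle (1 : ℚ), IsLocallyConstant b ∧
        ∀ σ τ, f' σ τ + b (σ * τ) = b σ + b τ by
    obtain ⟨b, hb, hbf⟩ := hmain (fun σ τ => f σ τ - f 1 1)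
      (by exact hf.comp fun x => x - f 1 1)
      (fun σ τ υ => by rw [sub_add_sub_comm, sub_add_sub_comm, hcoc]) (sub_self _)
    refine ⟨fun σ => b σ + f 1 1, hb.comp (· + f 1 1), fun σ τ => ?_⟩
    have h := hbf σ τ
    have h2 : f σ τ - f 1 1 + b (σ * τ) + f 1 1 + f 1 1 = b σ + b τ + f 1 1 + f 1 1 := by
      rw [h]
    calc f σ τ + (b (σ * τ) + f 1 1) = f σ τ - f 1 1 + b (σ * τ) + f 1 1 + f 1 1 := by abel
      _ = b σ + b τ + f 1 1 + f 1 1 := h2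
      _ = b σ + f 1 1 + (b τ + f 1 1) := by abel
  intro f hf hcoc h11
  -- Step A: the normalisation propagates
  have hf1 : ∀ σ, f σ 1 = 0 := by
    intro σ
    have h := hcoc σ 1 1
    rw [mul_one, one_mul, h11, zero_add] at h
    simpa using h
  -- Step B: `f` factors through a finite quotient
  obtain ⟨N, hN⟩ := exists_openNormalSubgroup_forall_mul_eq_of_isLocallyConstant₂ hf
  -- Step C: `f` is killed by some `N₀ > 0`
  obtain ⟨N₀, hN₀, hN₀f'⟩ :=
    addCircle_exists_nsmul_comp_eq_zero (Function.uncurry f) hf.range_finite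
  have hN₀f : ∀ σ τ, N₀ • f σ τ = 0 := fun σ τ => hN₀f' (σ, τ)
  -- Step D: a prime `ℓ` not dividing `N₀`
  obtain ⟨ℓ, hℓle, hℓp⟩ := Nat.exists_infinite_primes (N₀ + 1)
  have hℓN₀ : ¬ ℓ ∣ N₀ := Nat.not_dvd_of_pos_of_lt hN₀ (by omega)
  haveI : Fact ℓ.Prime := ⟨hℓp⟩
  -- Step E: natural-number representatives of the values of `f`
  have hrep : ∀ x : AddCircle (1 : ℚ), ∃ i : ℕ,
      N₀ • x = 0 → x = (((i : ℚ) / N₀ : ℚ) : AddCircle (1 : ℚ)) := by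
    intro x
    by_cases hx : N₀ • x = 0
    · obtain ⟨kk, hk⟩ := addCircle_exists_eq_intCast_div_of_nsmul_eq_zero hN₀.ne' hx
      refine ⟨(kk % N₀).toNat, fun _ => ?_⟩
      rw [hk]
      have h0 : 0 ≤ kk % N₀ := Int.emod_nonneg _ (by exact_mod_cast hN₀.ne')
      have hcast : (((kk % N₀).toNat : ℕ) : ℚ) = ((kk % N₀ : ℤ) : ℚ) := by
        exact_mod_cast Int.toNat_of_nonneg h0
      rw [hcast]
      apply (addCircle_intCast_div_eq_intCast_div_iff hN₀.ne' _ _).2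
      exact ⟨kk / N₀, by linarith [Int.emod_add_mul_ediv kk N₀]⟩
    · exact ⟨0, fun h => absurd h hx⟩
  choose jr hjr using hrep
  have hfj : ∀ σ τ, f σ τ = (((jr (f σ τ) : ℚ) / N₀ : ℚ) : AddCircle (1 : ℚ)) :=
    fun σ τ => hjr _ (hN₀f σ τ)
  have hj0 : (((jr 0 : ℚ) / N₀ : ℚ) : AddCircle (1 : ℚ)) = (((0 : ℕ) : ℚ) / N₀ : ℚ) := by
    rw [← hjr 0 (smul_zero _)]
    simp
  -- Step F: a primitive `N₀`-th root of unity in `ℚ̄_ℓ` and the multiplicative cocycle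
  haveI : NeZero (N₀ : PadicAlgCl ℓ) := ⟨Nat.cast_ne_zero.2 hN₀.ne'⟩
  obtain ⟨ξ, hξ⟩ := HasEnoughRootsOfUnity.exists_primitiveRoot (PadicAlgCl ℓ) N₀
  have hξ0 : ξ ≠ 0 := hξ.ne_zero hN₀.ne'
  set ξu : (PadicAlgCl ℓ)ˣ := Units.mk0 ξ hξ0 with hξu_def
  have hξu_val : (ξu : PadicAlgCl ℓ) = ξ := Units.val_mk0 hξ0
  have hξuN : ξu ^ N₀ = 1 :=
    Units.ext (by rw [Units.val_pow_eq_pow_val, hξu_val, hξ.pow_eq_one, Units.val_one])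
  have hξpow : ∀ {a b : ℕ}, (((a : ℚ) / N₀ : ℚ) : AddCircle (1 : ℚ)) =
      (((b : ℚ) / N₀ : ℚ) : AddCircle (1 : ℚ)) → ξu ^ a = ξu ^ b := by
    intro a b hab
    have h := (addCircle_intCast_div_eq_intCast_div_iff hN₀.ne' a b).1
      (by rw [Int.cast_natCast, Int.cast_natCast]; exact hab)
    obtain ⟨c, hc⟩ := h
    rw [← zpow_natCast, ← zpow_natCast, show ((a : ℕ) : ℤ) = b + N₀ * c by linarith, zpow_add,
      zpow_mul, zpow_natCast ξu N₀, hξuN, one_zpow, mul_one]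
  obtain ⟨zK, hzK_def⟩ : ∃ zK : absoluteGaloisGroup F → absoluteGaloisGroup F → (PadicAlgCl ℓ)ˣ,
      zK = fun σ τ => ξu ^ jr (f σ τ) := ⟨_, rfl⟩
  have hzK_coc : ∀ σ τ υ, zK σ τ * zK (σ * τ) υ = zK τ υ * zK σ (τ * υ) := by
    intro σ τ υ
    simp only [hzK_def, ← pow_add]
    apply hξpow
    push_cast
    rw [add_div, add_div, QuotientAddGroup.mk_add, QuotientAddGroup.mk_add, ← hfj, ← hfj, ← hfj,
      ← hfj]
    exact hcoc σ τ υ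
  have hzK_one : ∀ σ, zK σ 1 = 1 := by
    intro σ
    simp only [hzK_def, hf1]
    rw [← pow_zero ξu]
    exact hξpow hj0
  have hzK_N : ∀ σ τ, ∀ n₁ ∈ N, ∀ n₂ ∈ N, zK (σ * n₁) (τ * n₂) = zK σ τ := by
    intro σ τ n₁ hn₁ n₂ hn₂
    simp only [hzK_def, hN σ τ n₁ hn₁ n₂ hn₂]
  -- Step G–J: the continuous splitting in `ℚ̄_ℓˣ`
  obtain ⟨u, hu_cont, hu_mul⟩ :=
    exists_unit_cochain_of_Patrikis2019 hP F ℓ N zK hzK_N hzK_coc hzK_one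
  -- Step K: it has absolute value `1`
  have hξnorm1 : ‖ξ‖ = 1 := by
    have h : ‖ξ‖ ^ N₀ = 1 := by rw [← norm_pow, hξ.pow_eq_one, norm_one]
    exact (pow_eq_one_iff_of_nonneg (norm_nonneg ξ) hN₀.ne').1 h
  have hzK_val : ∀ σ τ, (zK σ τ : PadicAlgCl ℓ) = ξ ^ jr (f σ τ) := by
    intro σ τ
    simp only [hzK_def, Units.val_pow_eq_pow_val, hξu_val]
  have hzK_norm : ∀ σ τ, ‖(zK σ τ : PadicAlgCl ℓ)‖ = 1 := by
    intro σ τ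
    rw [hzK_val, norm_pow, hξnorm1, one_pow]
  have hu_norm : ∀ σ, ‖(u σ : PadicAlgCl ℓ)‖ = 1 :=
    eq_one_of_continuous_of_map_mul hu_cont.norm (fun σ => norm_pos_iff.2 (u σ).ne_zero)
      (fun σ τ => by
        rw [hu_mul]
        push_cast
        rw [norm_mul, norm_mul, hzK_norm, mul_one])
  -- Step L: reduction modulo the maximal ideal of `ℤ̄_ℓ`
  have hu_mul' : ∀ σ τ, (u (σ * τ) : PadicAlgCl ℓ) = u σ * u τ * ξ ^ jr (f σ τ) := by
    intro σ τ
    rw [hu_mul]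
    push_cast
    rw [hzK_val]
  obtain ⟨β, ξ', hβ_lc, hξ'N, hξ'inj, hβ_mul⟩ := PadicAlgCl.exists_residue_cochain ℓ hN₀ hℓN₀ hξ
    (fun σ τ => jr (f σ τ)) hu_cont hu_norm hu_mul'
  -- Steps M–O: back to `ℚ/ℤ`
  obtain ⟨b, hb, hbf⟩ := addCircle_split_of_unit_cochain hN₀ hξ'N hξ'inj
    (fun σ τ => jr (f σ τ)) hβ_lc hβ_mul
  refine ⟨b, hb, fun σ τ => ?_⟩
  rw [hfj]
  exact hbf σ τ

/-- **`Tate_projectiveLifting` from the `ℓ`-adic lifting theorem.**  The named fact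
`Patrikis2019_exists_lift_projective` (i) (Tate–Conrad–Patrikis, `ProjectiveLifting.lean`)
implies Tate's theorem for `ℚ` in cochain form (`twoCocycle_addCircle_split_of_Patrikis2019`
with `F = ℚ`), hence `Tate_projectiveLifting` (`Tate_projectiveLifting_of_H2_addCircle`): the
two avatars of Tate's lifting theorem in this tree are thereby tied to one and the same
class-field-theoretic input, `H²(G_ℚ, ℚ/ℤ) = 0` (Serre, Durham §6.5).
[cite: SerreDurham1977, §6.1 Thm. 4 (Tate), Corollary; §6.5] [cite: Patrikis2019, §2.1] -/
theorem Tate_projectiveLifting_of_Patrikis2019 (hP : Patrikis2019_exists_lift_projective) :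
    Tate_projectiveLifting :=
  Tate_projectiveLifting_of_H2_addCircle fun f hf hcoc =>
    twoCocycle_addCircle_split_of_Patrikis2019 hP ℚ f hf hcoc

end FromPatrikis

end Literature.NumberTheory.GaloisRepresentations
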